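import Literature.NumberTheory.DiophantineGeometry.ApproximationBoundRat
import Literature.NumberTheory.DiophantineGeometry.ApproximationBoundRatPadicUnitsProofs
import Literature.NumberTheory.DiophantineGeometry.ApproximationBoundRatArchDependenceProofs
import HarnessLib

/-!
# The archimedean approximation bound over `ℚ` ("A1.L(∞)") from a lower bound for linear forms in
# logarithms of positive rationals in SHAPE form (Evertse–Győry §4.4.2 at `α = 1`)

Topic `NumberTheory/DiophantineGeometry`; namespace `Literature.NumberTheory.DiophantineGeometry.Dioph`.
Proofs only: no definition, no named fact. Archimedean twin of
`ApproximationBoundRatPadicOfCoreProofs.lean` / `…PadicOfCoresProofs.lean`.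

* `archApproximationBound_rat_of_depArch` — `archApproximationBound_rat` (Pasten 2024 Thm 2.1 (i),
  `d = 1`, `∃ K ≥ 1`) from the shape bound for DEPENDENT positive rationals (additive slot
  `log B + ∑ log(3h(aₖ)) + 2n`, the form written `log ∏ aₖ^{bₖ}`): small exponents
  (`exists_small_exponents`), Case B by `liouville_infinite`/`eg421_caseB_bound`, Case A — only when
  `|1 − x| < ½`, else trivial — through `aᵢ := |ξ'ᵢ|` (positive, same heights, `∏ aᵢ^{b'ᵢ} = x`),
  the slot lemma `caseA_logslot_le` at `p = 1`, and `|log x| ≤ 2|x − 1|` (private helper).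
* `indepArch_of_archCore` — the independent core on any finite index type from its `Fin r` text.
* `archApproximationBound_rat_of_archCore (hArch)` — from ONE hypothesis: the text of Nesterenko
  2003 Thm 2.2 (= Matveev 2000 over `ℚ`) in the `cⁿ` shape for positive independent rationals
  (the cell `abc-stewartyu`'s planned crux `ArchCoreRat`; NOT proved here).

## References

* [EvertseGyory2015] J.-H. Evertse, K. Győry, *Unit Equations in Diophantine Number Theory*,
  CUP 2015 — Thm 4.2.1 (p. 68), proof §4.4.2 (pp. 80–81).
* [Nesterenko2003] Yu. V. Nesterenko, *Linear forms in logarithms of rational numbers*, LNM 1819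
  (2003) — Thm 2.2, Lemma 2.3.
* [Pasten2024] H. Pasten, Invent. Math. 236 (2024) — Theorem 2.1 (i) with `d = 1`.
-/

noncomputable section

open Finset Real Height

namespace Literature.NumberTheory.DiophantineGeometry.Dioph

/-! ### Elementary lemmas -/

/-- `|log x| ≤ 2|x − 1|` for `|x − 1| ≤ ½` (Nesterenko 2003, Lemma 2.3 in crude form). Private copy
of `Literature.NumberTheory.Automorphic.abs_log_le_two_mul` (`LocalWeylLaw.lean`), not imported here
so that the Diophantine-geometry import closure stays free of the automorphic spectral chain.
[cite: Nesterenko2003, Lemma 2.3] -/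
private theorem abs_log_le_two_mul_abs_sub_one {x : ℝ} (hx : |x - 1| ≤ 1 / 2) :
    |Real.log x| ≤ 2 * |x - 1| := by
  have h1 : 1 / 2 ≤ x := by have := (abs_le.mp hx).1; linarith
  have h2 : x ≤ 3 / 2 := by have := (abs_le.mp hx).2; linarith
  have hx0 : 0 < x := by linarith
  rcases le_or_gt 1 x with h | h
  · -- `x ≥ 1`: `0 ≤ log x ≤ x - 1`
    have hl0 : 0 ≤ Real.log x := Real.log_nonneg h
    have hl1 : Real.log x ≤ x - 1 := Real.log_le_sub_one_of_pos hx0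
    rw [abs_of_nonneg hl0, abs_of_nonneg (by linarith)]
    linarith
  · -- `x < 1`: `0 ≤ -log x = log x⁻¹ ≤ x⁻¹ - 1 = (1 - x)/x ≤ 2(1 - x)`
    have hl0 : Real.log x < 0 := Real.log_neg hx0 h
    have hinv : Real.log x⁻¹ ≤ x⁻¹ - 1 := Real.log_le_sub_one_of_pos (inv_pos.mpr hx0)
    rw [Real.log_inv] at hinv
    have h3 : x⁻¹ - 1 ≤ 2 * (1 - x) := by
      rw [inv_eq_one_div, div_sub_one hx0.ne', div_le_iff₀ hx0]
      nlinarith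
    rw [abs_of_neg hl0, abs_of_neg (by linarith)]
    linarith

/-- `3 ≤ pastenK`. [folklore] -/
private theorem three_le_pastenK : 3 ≤ pastenK := by
  rw [pastenK_def]
  have h1 : (1 : ℝ) ≤ 16 * Real.exp 1 := by
    have := Real.add_one_le_exp (1 : ℝ); nlinarith
  have h2 : (1 : ℝ) ≤ (16 * Real.exp 1) ^ 8 := one_le_pow₀ h1
  nlinarith


/-! ### Case A through the dependent core -/

/-- **Case A of Evertse–Győry §4.4.2 at `α = 1`, `v = ∞`, through the dependent archimedean core.**
For the height-minimal system `ξ'` with small exponents (`|b'ᵢ| ≤ B₀ = m^{2m} h(x)/log 2`,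
`x = ζ' ∏ ξ'ᵢ^{b'ᵢ} ≠ 1`, `|1 − x| < ½`) in Case A (`2e·9^{m+1}·Θ' ≤ B₀`): with `aᵢ := |ξ'ᵢ|`
(positive, same heights, `∏ aᵢ^{b'ᵢ} = x`) the hypothesis `hdep` and `|log x| ≤ 2|x − 1|` give
`log|1 − x| ≥ −(16C)^m · log max(e, h(x)) · Θ' − log 2`.
[cite: EvertseGyory2015, §4.4.2 (pp. 80–81)] [cite: Nesterenko2003, Lemma 2.3] -/
theorem caseA_arch_bound {C : ℝ} (hC : 1 ≤ C)
    (hdep : ∀ (κ : Type) [Fintype κ] [DecidableEq κ] (a : κ → ℚ) (b : κ → ℤ) (B : ℝ),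
      (∀ k, 0 < a k) → (∀ k, a k ≠ 1) → (∀ k, (|b k| : ℝ) ≤ B) → 3 ≤ B → ∏ k, a k ^ b k ≠ 1 →
      -(C ^ Fintype.card κ * (∏ k, logHeight₁ (a k)) *
          (Real.log B + ∑ k, Real.log (3 * logHeight₁ (a k)) + 2 * Fintype.card κ)) ≤
        Real.log |Real.log ((∏ k, a k ^ b k : ℚ) : ℝ)|)
    {ι : Type} [Fintype ι] [DecidableEq ι] {n : ℕ} (hcard : Fintype.card ι = n + 1)
    (ξ : ι → ℚ) (hξ : ∀ i, ξ i ≠ 0 ∧ ξ i ≠ 1 ∧ ξ i ≠ -1) (ζ : ℚ) (hζ : ζ = 1 ∨ ζ = -1)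
    (b : ι → ℤ) {x : ℚ} (hx : x = ζ * ∏ i, ξ i ^ b i) (hx1 : x ≠ 1)
    (hnear : |1 - (x : ℝ)| < 1 / 2) {B₀ : ℝ}
    (hB₀ : B₀ = (Fintype.card ι : ℝ) ^ (2 * Fintype.card ι) * logHeight₁ x / Real.log 2)
    (hb : ∀ i, (|b i| : ℝ) ≤ B₀)
    (hcase : 2 * Real.exp 1 * 9 ^ (Fintype.card ι + 1) * (∏ i, logHeight₁ (ξ i)) ≤ B₀) :
    -((16 * C) ^ Fintype.card ι * Real.log (max (Real.exp 1) (logHeight₁ x)) *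
        ∏ i, logHeight₁ (ξ i)) - Real.log 2 ≤ Real.log |1 - (x : ℝ)| := by
  set m := Fintype.card ι with hm
  set Θ' := ∏ i, logHeight₁ (ξ i) with hΘ'
  set L := Real.log (max (Real.exp 1) (logHeight₁ x)) with hL
  have hm1 : 1 ≤ m := by omega
  have hl2 : 0 < Real.log 2 := Real.log_pos one_lt_two
  have hL1 : 1 ≤ L := by
    rw [hL, ← Real.log_exp 1]
    exact Real.log_le_log (Real.exp_pos 1) (by rw [Real.log_exp]; exact le_max_left _ _)
  have hxR1 : (x : ℝ) ≠ 1 := by exact_mod_cast hx1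
  have hxpos : 0 < (x : ℝ) := by have := (abs_lt.mp hnear).2; linarith
  have hxposQ : (0 : ℚ) < x := by exact_mod_cast hxpos
  have hζ1 : |ζ| = 1 := by rcases hζ with rfl | rfl <;> norm_num
  -- the positive system `aᵢ = |ξᵢ|`
  set a : ι → ℚ := fun i => |ξ i| with ha
  have hapos : ∀ i, 0 < a i := fun i => abs_pos.mpr (hξ i).1
  have ha1 : ∀ i, a i ≠ 1 := by
    intro i h1
    rcases abs_eq (zero_le_one' ℚ) |>.mp h1 with h2 | h2
    · exact (hξ i).2.1 h2
    · exact (hξ i).2.2 h2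
  have hah : ∀ i, logHeight₁ (a i) = logHeight₁ (ξ i) := fun i => logHeight₁_abs (ξ i)
  have haprod : ∏ i, a i ^ b i = x := by
    calc ∏ i, a i ^ b i = ∏ i, |ξ i ^ b i| := Finset.prod_congr rfl fun i _ => (abs_zpow _ _).symm
      _ = |∏ i, ξ i ^ b i| := (Finset.abs_prod _ _).symm
      _ = |ζ * ∏ i, ξ i ^ b i| := by rw [abs_mul, hζ1, one_mul]
      _ = x := by rw [← hx]; exact abs_of_pos hxposQ
  have hne' : ∏ i, a i ^ b i ≠ 1 := by rw [haprod]; exact hx1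
  -- `h(x) > 0`, `Θ' ≥ (log 2)^m`, `B₀ ≥ 3`
  have hhx : 0 < logHeight₁ x := lt_of_lt_of_le hl2 (log_two_le_logHeight₁ hxposQ.ne' hx1
    (by intro h; rw [h] at hxposQ; norm_num at hxposQ))
  have hΘ'low : Real.log 2 ^ m ≤ Θ' := by
    have : ∏ _i : ι, Real.log 2 = Real.log 2 ^ m := by rw [Finset.prod_const, Finset.card_univ]
    rw [← this]
    exact Finset.prod_le_prod (fun i _ => hl2.le) fun i _ =>
      log_two_le_logHeight₁ (hξ i).1 (hξ i).2.1 (hξ i).2.2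
  have hΘ'0 : 0 ≤ Θ' := Finset.prod_nonneg fun i _ => zero_le_logHeight₁ _
  have hB3 : 3 ≤ B₀ := by
    have h1 : (1 / 2 : ℝ) ^ m ≤ Θ' := le_trans (pow_le_pow_left₀ (by norm_num)
      (by linarith [Real.log_two_gt_d9]) m) hΘ'low
    have he : (1 : ℝ) ≤ Real.exp 1 := Real.one_le_exp zero_le_one
    have h3 : (9 : ℝ) ^ (m + 1) * (1 / 2) ^ m = 9 * (9 * (1 / 2)) ^ m := by
      rw [pow_succ, mul_pow]; ring
    have h4 : (1 : ℝ) ≤ (9 * (1 / 2)) ^ m := one_le_pow₀ (by norm_num)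
    have h5 : (9 : ℝ) ≤ 9 ^ (m + 1) * (1 / 2) ^ m := by rw [h3]; nlinarith
    have h6 : 2 * Real.exp 1 * 9 ^ (m + 1) * (1 / 2 : ℝ) ^ m ≤ 2 * Real.exp 1 * 9 ^ (m + 1) * Θ' :=
      mul_le_mul_of_nonneg_left h1 (by positivity)
    have h7 : 2 * Real.exp 1 * 9 ^ (m + 1) * (1 / 2 : ℝ) ^ m =
        (2 * Real.exp 1) * (9 ^ (m + 1) * (1 / 2) ^ m) := by ring
    nlinarith
  -- the dependent core
  have hmain := hdep ι a b B₀ hapos ha1 hb hB3 hne'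
  rw [haprod] at hmain
  simp only [hah] at hmain
  -- the slot
  obtain ⟨n', hn'⟩ : ∃ n', Fintype.card ι = n' + 1 := ⟨n, hcard⟩
  have hcase' : 2 * Real.exp 1 * 9 ^ (n' + 1 + 1) * (∏ j, logHeight₁ (ξ j)) ≤ B₀ := by
    rw [← hn']; exact hcase
  have h2h : ∀ i, 2 * logHeight₁ (ξ i) ≤ B₀ := two_mul_logHeight₁_le_of_caseA hn' ξ hξ hcase'
  have hslotA := caseA_logslot_le m hm1 hhx (le_refl (1 : ℝ)) hB₀ hB3
  rw [Real.log_one, one_mul] at hslotA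
  have hsum : ∑ i, Real.log (3 * logHeight₁ (ξ i)) ≤ (m : ℝ) * Real.log (3 * B₀) := by
    have h1 : ∑ i, Real.log (3 * logHeight₁ (ξ i)) ≤ ∑ _i : ι, Real.log (3 * B₀) := by
      apply Finset.sum_le_sum; intro i _
      have hpos : 0 < 3 * logHeight₁ (ξ i) := by
        linarith [log_two_le_logHeight₁ (hξ i).1 (hξ i).2.1 (hξ i).2.2]
      exact Real.log_le_log hpos (by linarith [h2h i])
    rwa [Finset.sum_const, Finset.card_univ, nsmul_eq_mul] at h1
  have hlogB0 : 0 ≤ Real.log B₀ := Real.log_nonneg (by linarith)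
  have hm0 : (0 : ℝ) ≤ m := by positivity
  have hslot : Real.log B₀ + ∑ i, Real.log (3 * logHeight₁ (ξ i)) + 2 * (m : ℝ) ≤ 16 ^ m * L := by
    have : (m : ℝ) * Real.log B₀ ≥ 0 := mul_nonneg hm0 hlogB0
    linarith
  have hCm0 : 0 ≤ C ^ m := pow_nonneg (by linarith) m
  have hlow : -((16 * C) ^ m * L * Θ') ≤ Real.log |Real.log (x : ℝ)| := by
    have h1 : C ^ m * Θ' * (Real.log B₀ + ∑ i, Real.log (3 * logHeight₁ (ξ i)) + 2 * (m : ℝ)) ≤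
        C ^ m * Θ' * (16 ^ m * L) := mul_le_mul_of_nonneg_left hslot (mul_nonneg hCm0 hΘ'0)
    have h3 : C ^ m * Θ' * (16 ^ m * L) = (16 * C) ^ m * L * Θ' := by rw [mul_pow]; ring
    linarith
  -- `log|1 - x| ≥ log|log x| - log 2`
  have habs : |(x : ℝ) - 1| ≤ 1 / 2 := by rw [abs_sub_comm]; exact hnear.le
  have hlink := abs_log_le_two_mul_abs_sub_one habs
  have hlogx0 : Real.log (x : ℝ) ≠ 0 := Real.log_ne_zero_of_pos_of_ne_one hxpos hxR1
  have h1 : |Real.log (x : ℝ)| / 2 ≤ |1 - (x : ℝ)| := by rw [abs_sub_comm] at hlink; linarith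
  have h2 := Real.log_le_log (by positivity) h1
  rw [Real.log_div (abs_ne_zero.mpr hlogx0) two_ne_zero] at h2
  linarith

/-! ### The archimedean half from the dependent core -/

/-- **The archimedean approximation bound over `ℚ` ("A1.L(∞)", `archApproximationBound_rat`:
Pasten 2024 Thm 2.1 (i), `d = 1`, constant existential) from a lower bound in SHAPE form for
linear forms in logarithms of DEPENDENT positive rationals** (`hdep`: positive `aₖ ≠ 1`,
`|bₖ| ≤ B`, `B ≥ 3`, `∏ aₖ^{bₖ} ≠ 1` ⟹
`log|log ∏ aₖ^{bₖ}| ≥ −Cⁿ·∏ h(aₖ)·(log B + ∑ log(3h(aₖ)) + 2n)`). Proof = Evertse–Győry §4.4.2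
at `K = ℚ`, `α = 1`, `v = ∞`: small exponents, Case B by Liouville, Case A (when `|1 − x| < ½`)
by `caseA_arch_bound`; `K := max(pastenK, 32C)`.
[cite: EvertseGyory2015, Thm 4.2.1 (p. 68), proof pp. 80–81] [cite: Pasten2024, Theorem 2.1 (i) (d = 1)] -/
theorem archApproximationBound_rat_of_depArch {C : ℝ} (hC : 1 ≤ C)
    (hdep : ∀ (κ : Type) [Fintype κ] [DecidableEq κ] (a : κ → ℚ) (b : κ → ℤ) (B : ℝ),
      (∀ k, 0 < a k) → (∀ k, a k ≠ 1) → (∀ k, (|b k| : ℝ) ≤ B) → 3 ≤ B → ∏ k, a k ^ b k ≠ 1 →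
      -(C ^ Fintype.card κ * (∏ k, logHeight₁ (a k)) *
          (Real.log B + ∑ k, Real.log (3 * logHeight₁ (a k)) + 2 * Fintype.card κ)) ≤
        Real.log |Real.log ((∏ k, a k ^ b k : ℚ) : ℝ)|) :
    archApproximationBound_rat := by
  classical
  set K := max pastenK (32 * C) with hK
  have hK1 : 1 ≤ K := le_max_of_le_left one_le_pastenK
  have hK3 : 3 ≤ K := le_max_of_le_left three_le_pastenK
  refine ⟨K, hK1, fun ι _ hι ξ hξ ζ hζ b hne => ?_⟩
  obtain ⟨ξ', ζ', b', hξ', hζ', hxeq, hΘle, hb'⟩ := exists_small_exponents hι ξ hξ ζ hζ b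
  set m := Fintype.card ι with hm
  set x : ℚ := ζ * ∏ i, ξ i ^ b i with hxdef
  set Θ := ∏ i, logHeight₁ (ξ i) with hΘ
  set Θ' := ∏ i, logHeight₁ (ξ' i) with hΘ'
  set L := Real.log (max (Real.exp 1) (logHeight₁ x)) with hL
  have hl2 : 0 < Real.log 2 := Real.log_pos one_lt_two
  have hk2 : Real.exp 1 ≤ 2 / Real.log 2 := exp_one_le_div_log one_lt_two
  have hL1 : 1 ≤ L := by
    rw [hL, ← Real.log_exp 1]
    exact Real.log_le_log (Real.exp_pos 1) (by rw [Real.log_exp]; exact le_max_left _ _)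
  have hΘlow : Real.log 2 ^ m ≤ Θ := by
    have : ∏ _i : ι, Real.log 2 = Real.log 2 ^ m := by rw [Finset.prod_const, Finset.card_univ]
    rw [← this]
    exact Finset.prod_le_prod (fun i _ => hl2.le) fun i _ =>
      log_two_le_logHeight₁ (hξ i).1 (hξ i).2.1 (hξ i).2.2
  have hΘpos : 0 < Θ := lt_of_lt_of_le (pow_pos hl2 m) hΘlow
  have hLΘ : 0 ≤ L * Θ := by positivity
  -- `D^m L Θ ≥ 2` for `D ≥ 3` (used with `D = K` and `D = 16C`)
  have hbig : ∀ D : ℝ, 3 ≤ D → 2 ≤ D ^ m * L * Θ := by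
    intro D hD
    have h2 : (2 : ℝ) ≤ D * Real.log 2 := by
      have : 3 * Real.log 2 ≤ D * Real.log 2 := mul_le_mul_of_nonneg_right hD hl2.le
      linarith [Real.log_two_gt_d9]
    have h1 : (2 : ℝ) ≤ (D * Real.log 2) ^ m :=
      calc (2 : ℝ) = 2 ^ 1 := by norm_num
        _ ≤ 2 ^ m := pow_le_pow_right₀ (by norm_num) hι
        _ ≤ (D * Real.log 2) ^ m := pow_le_pow_left₀ (by norm_num) h2 m
    have hD0 : 0 ≤ D ^ m := pow_nonneg (by linarith) m
    calc (2 : ℝ) ≤ (D * Real.log 2) ^ m := h1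
      _ = D ^ m * 1 * Real.log 2 ^ m := by rw [mul_pow]; ring
      _ ≤ D ^ m * L * Θ :=
          mul_le_mul (mul_le_mul_of_nonneg_left hL1 hD0) hΘlow (pow_nonneg hl2.le m)
            (by positivity)
  have hRHS2 : 2 ≤ K ^ m * L * Θ := hbig K hK3
  have hlog2 : Real.log 2 < 1 := by linarith [Real.log_two_lt_d9]
  have hx1 : x ≠ 1 := hne
  have hcast : ((1 - x : ℚ) : ℝ) = 1 - (x : ℝ) := by push_cast; ring
  -- trivial when `|1 - x| ≥ 1/2`
  by_cases hfar : (1 / 2 : ℝ) ≤ |1 - (x : ℝ)|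
  · have h1 : Real.log (1 / 2) ≤ Real.log |1 - (x : ℝ)| := Real.log_le_log (by norm_num) hfar
    rw [Real.log_div one_ne_zero two_ne_zero, Real.log_one, zero_sub] at h1
    linarith
  push Not at hfar
  set B₀ : ℝ := (m : ℝ) ^ (2 * m) * logHeight₁ x / Real.log 2 with hB₀
  by_cases hcase : 2 * Real.exp 1 * 9 ^ (m + 1) * Θ' ≤ B₀
  · -- Case A
    obtain ⟨n, hn⟩ : ∃ n, Fintype.card ι = n + 1 := ⟨m - 1, by omega⟩
    have hA := caseA_arch_bound hC hdep hn ξ' hξ' ζ' hζ' b' hxeq hx1 hfar hB₀ hb' hcase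
    have hC16 : (3 : ℝ) ≤ 16 * C := by linarith
    have h16 := hbig (16 * C) hC16
    -- `K^m ≥ 2 (16C)^m`
    have hK16 : 2 * (16 * C) ^ m ≤ K ^ m := by
      have h1 : (32 * C) ^ m ≤ K ^ m := pow_le_pow_left₀ (by positivity) (le_max_right _ _) m
      have h2 : (32 * C) ^ m = 2 ^ m * (16 * C) ^ m := by rw [← mul_pow]; ring
      have h3 : (2 : ℝ) ≤ 2 ^ m :=
        calc (2 : ℝ) = 2 ^ 1 := by norm_num
          _ ≤ 2 ^ m := pow_le_pow_right₀ (by norm_num) hι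
      have h4 : 2 * (16 * C) ^ m ≤ 2 ^ m * (16 * C) ^ m :=
        mul_le_mul_of_nonneg_right h3 (pow_nonneg (by positivity) m)
      linarith
    have hΘ'Θ : (16 * C) ^ m * L * Θ' ≤ (16 * C) ^ m * L * Θ :=
      mul_le_mul_of_nonneg_left hΘle (by positivity)
    have hfin : 2 * ((16 * C) ^ m * L * Θ) ≤ K ^ m * L * Θ := by
      have h1 := mul_le_mul_of_nonneg_right hK16 hLΘ
      have e1 : 2 * (16 * C) ^ m * (L * Θ) = 2 * ((16 * C) ^ m * L * Θ) := by ring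
      have e2 : K ^ m * (L * Θ) = K ^ m * L * Θ := by ring
      rw [e1, e2] at h1
      exact h1
    linarith
  · -- Case B: Liouville
    push Not at hcase
    have hm1 : (1 : ℝ) ≤ m := by exact_mod_cast hι
    have hhx0 : 0 ≤ logHeight₁ x := zero_le_logHeight₁ _
    have hxB : logHeight₁ x ≤ B₀ := by
      rw [hB₀, le_div_iff₀ hl2]
      have h1 : (1 : ℝ) ≤ (m : ℝ) ^ (2 * m) := one_le_pow₀ hm1
      nlinarith
    have hΘ'Θ : 2 * Real.exp 1 * 9 ^ (m + 1) * Θ' ≤ 2 * Real.exp 1 * 9 ^ (m + 1) * Θ :=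
      mul_le_mul_of_nonneg_left hΘle (by positivity)
    have ht : Real.log 2 + logHeight₁ x <
        Real.log 2 + 1 + 2 * Real.exp 1 * 9 ^ (m + 1) * Θ * 1 := by linarith
    have h1 := liouville_infinite hx1
    rw [hcast] at h1
    have h2 := eg421_caseB_bound m hι (k := 2 / Real.log 2) (L := L) (H := 1) hΘlow le_rfl hk2
      hL1 ht
    have hc8 : egC8 m * (2 / Real.log 2) ≤ K ^ m := by
      have h5 := five_mul_egC8_le m hι
      have h0 := egC8_nonneg m
      have hKK : pastenK ^ m ≤ K ^ m :=
        pow_le_pow_left₀ (le_trans zero_le_one one_le_pastenK) (le_max_left _ _) m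
      have hdl : 2 / Real.log 2 ≤ 5 := by
        rw [div_le_iff₀ hl2]; linarith [Real.log_two_gt_d9]
      have h6 : egC8 m * (2 / Real.log 2) ≤ egC8 m * 5 := mul_le_mul_of_nonneg_left hdl h0
      linarith
    have h3 : egC8 m * (2 / Real.log 2) * Θ * 1 * L ≤ K ^ m * L * Θ := by
      have e1 : egC8 m * (2 / Real.log 2) * Θ * 1 * L = (egC8 m * (2 / Real.log 2)) * (L * Θ) := by
        ring
      rw [e1, show K ^ m * L * Θ = K ^ m * (L * Θ) by ring]
      exact mul_le_mul_of_nonneg_right hc8 hLΘ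
    linarith

end Literature.NumberTheory.DiophantineGeometry.Dioph

end
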